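import Mathlib
import Summits.ValiantsHypothesis.ValiantsHypothesis.Theorems.NewtonUnitEquationsDissociatedUniformTotalsLaw
import Literature.Computability.AlgebraicComplexity.NewtonPolygonTauProductBounds
import HarnessLib

/-!
# Crux `NewtonUnitEquations.DissociatedUniform` (stmt-ValiantsHypothesis-5905), `n = 3` totals law of model (Q**):
# the RANK-ONE stratum (three collinear alphabets) and its one-parameter ENVELOPE problem — definitions, located conjectures,
# the six sector instances

Model (Q**) (`…TotalsLaw`: `classPts a b c s = {a x + b y + c z : x + y + z = s}`, `V_s = classVert`, `T = totalVert`).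
THIS FILE isolates the stratum in which the three alphabets are RANK ONE, i.e. lie on three lines through the origin in
general position; after an affine change of coordinates `a x = (α x, 0)`, `b y = (0, β y)`, `c z = (γ z, γ z)` with ARBITRARY
real labellings `α β γ : G → ℝ` (`rankOneA`, `rankOneB`, `rankOneC`).  Every landed stratum of the programme restricts the
LABELLINGS or the POSITION SETS (convex position, cosets, intervals, boxes, AP heights, lattices); here the labellings are
unrestricted and only the geometry is special.  Memo `Cruxes/DissociatedUniform/NOTES-t1g19.md`.  The companion file
`…TotalsLawRankOneReduction` proves the reduction `V_s ≤ ∑_{k ≤ 6} envPieces (instance k)` and its consequences.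

* THE ENVELOPE PROBLEM (ENV).  For `φ ψ c : G → ℝ` put `envPt (x, y) = (ψ y + c (x+y), φ x + c (x+y)) ∈ ℝ²` and let
  `envPieces φ ψ c` be the number of points of `envPts = {envPt (x,y)}` that are SOUTH-WEST EXPOSED: strict minimisers of
  `(1-τ)·X + τ·Y` for some `τ ∈ [0,1]` (`IsSWExposed`, `swCount`; equivalently the pieces, counted as distinct lines, of the lower
  envelope on `[0,1]` of the `|G|²` lines `τ ↦ τ φ x + (1-τ) ψ y + c (x+y)`).  `@[conjecture] EnvelopeBound C :
  envPieces ≤ C·|G|` — OPEN; census (memo §3, exact rational arithmetic, annealing in log-scale): cyclic groups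
  `|G| = 4, …, 8`: the maximum found is `2|G| + 1`, never more (integer intervals of `n` rows and columns inside a large cyclic
  group: `2n + 2` at `n = 4`, else `2n + 1`); located `C = 3` (`C = 2` fails at `|G| = 4`: `9 > 8`).  Heuristic of the
  extremisers (memo §3): rows `x` "die" in order of decreasing `φ`, columns `y` are "born" in order of increasing `ψ`; but rows
  re-enter, columns are re-used and no single index sequence is Davenport–Schinzel of bounded order, so the bound is a joint
  phenomenon (memo §4 lists the dead simple invariants).  Trivial bound `|G|²` (`envPieces_le_card_sq`).
* THE RANK-ONE CLASS: `rkPt`, `rkFin`, `coe_rkFin`; located `@[conjecture] RankOnePointwise C` (`V_s ≤ C|G|` for EVERY class;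
  census memo §2: `max_s V_s / |G| = 3.75, 3.2, 3.17` at `|G| = 8, 10, 12` under annealing, `T/|G|² ≤ 2.39`).  CONTRAST: for
  planar alphabets a single class can have `|G|²/4` vertices (parabola gadget, `…TotalsLawParabolaGadget`), so a pointwise law
  is a rank-one phenomenon — the gadget needs curvature.
* THE SIX SECTORS: a hull vertex is a strict top for a weight `(u, v)`; the rank-one score of a word is
  `u α x + v β y + (u+v) γ z`, and the six sectors cut out by the directions `±(1,0), ±(0,1), ±(1,-1)` (where one alphabet is
  invisible) each turn the class into an (ENV) instance by an injective linear map: sector maps `L₁ … L₆`, instances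
  `inst₁ … inst₆` = `(∓α, ∓β, ∓γ(s-·))`, `(±β, ∓γ, ∓α(s-·))`, `(±α, ∓γ, ∓β(s-·))`, identification `envPts_instₖ :
  envPts (instₖ) = Lₖ (class s)` (the mixed instances re-index cells by `eYZ : (x,y) ↦ (y,z)`, `eXZ : (x,y) ↦ (x,z)`), and the
  transport lemma `isStrictTop_image_of_compat`.
Honest label: definitions, located conjectures and bookkeeping; `EnvelopeBound`, `RankOnePointwise`, `TotalsLawThree` are OPEN
and asserted nowhere; VP ≠ VNP is not touched.
[folklore: a vertex of the hull of a finite planar set is a strict maximiser of a linear functional; affine images]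
-/

set_option linter.dupNamespace false -- `ValiantsHypothesis.ValiantsHypothesis` (summit = problem) in every name

open scoped BigOperators
open Matrix Finset

namespace Summit.ValiantsHypothesis.ValiantsHypothesis.Theorems.NewtonUnitEquationsDissociatedUniform

namespace TotalsLaw

open Literature.Computability.AlgebraicComplexity.KPTT.PlanarMinkowski

/-! ### South-west exposed points of a finite planar set -/

/-- `p` is SOUTH-WEST EXPOSED in the finite planar set `P`: for some `τ ∈ [0,1]` it is the strict minimiser over `P` of
`(1-τ)·X + τ·Y`, i.e. the strict top for the weight `(-(1-τ), -τ)`. -/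
def IsSWExposed (P : Finset (Fin 2 → ℝ)) (p : Fin 2 → ℝ) : Prop :=
  ∃ τ : ℝ, 0 ≤ τ ∧ τ ≤ 1 ∧ IsStrictTop ![-(1 - τ), -τ] P p

open Classical in
/-- The number of south-west exposed points of `P` (the vertices of the lower-left convex chain of `P`, from its lowest-`X`
contact point to its lowest-`Y` contact point). -/
noncomputable def swCount (P : Finset (Fin 2 → ℝ)) : ℕ := (P.filter (IsSWExposed P)).card

/-- Trivially `swCount P ≤ #P`. [folklore] -/
theorem swCount_le_card (P : Finset (Fin 2 → ℝ)) : swCount P ≤ P.card := by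
  classical
  unfold swCount
  convert Finset.card_filter_le P (IsSWExposed P)

/-! ### The envelope problem (ENV) on `G × G` -/

section Env

variable {G : Type*} [AddCommGroup G] [Fintype G]

/-- The (ENV) point of the cell `(x, y)`: `(ψ y + c (x+y), φ x + c (x+y))` — the values at `τ = 0` and `τ = 1` of the line
`τ ↦ τ φ x + (1-τ) ψ y + c (x+y)`. -/
def envPt (φ ψ c : G → ℝ) (p : G × G) : Fin 2 → ℝ := ![ψ p.2 + c (p.1 + p.2), φ p.1 + c (p.1 + p.2)]

/-- The (ENV) point set `{envPt (x, y) : (x, y) ∈ G × G}`. -/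
noncomputable def envPts (φ ψ c : G → ℝ) : Finset (Fin 2 → ℝ) := by
  classical exact Finset.univ.image (envPt φ ψ c)

/-- `envPieces φ ψ c`: the number of south-west exposed points of the (ENV) point set = the number of pieces of the lower
envelope on `τ ∈ [0,1]` of the lines `τ φ x + (1-τ) ψ y + c (x+y)` (pieces counted as distinct lines). -/
noncomputable def envPieces (φ ψ c : G → ℝ) : ℕ := swCount (envPts φ ψ c)

/-- Trivial bound `envPieces ≤ |G|²`. [folklore] -/
theorem envPieces_le_card_sq (φ ψ c : G → ℝ) : envPieces φ ψ c ≤ Fintype.card G ^ 2 := by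
  classical
  unfold envPieces
  refine (swCount_le_card _).trans ?_
  unfold envPts
  refine Finset.card_image_le.trans ?_
  rw [Finset.card_univ, Fintype.card_prod, sq]

end Env

/-- **The envelope bound with constant `C`** (conjecture-grade, OPEN; memo NOTES-t1g19 §3): for every finite abelian group `G`
and all `φ ψ c : G → ℝ`, the lower envelope on `[0,1]` of the `|G|²` lines `τ φ x + (1-τ) ψ y + c (x+y)` has at most `C·|G|`
pieces (as south-west exposed points of `envPts`).  Census: maximum `2|G| + 1` on cyclic groups `|G| ≤ 8`; located `C = 3`.
Not asserted anywhere. -/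
@[conjecture] def EnvelopeBound (C : ℕ) : Prop :=
  ∀ (G : Type) [AddCommGroup G] [Fintype G] (φ ψ c : G → ℝ), envPieces φ ψ c ≤ C * Fintype.card G

/-! ### The rank-one alphabets -/

section RankOne

variable {G : Type*} [AddCommGroup G] [Fintype G]

/-- First rank-one alphabet: `a x = (α x, 0)`. -/
def rankOneA (α : G → ℝ) (x : G) : Fin 2 → ℝ := ![α x, 0]

/-- Second rank-one alphabet: `b y = (0, β y)`. -/
def rankOneB (β : G → ℝ) (y : G) : Fin 2 → ℝ := ![0, β y]

/-- Third rank-one alphabet, on the diagonal: `c z = (γ z, γ z)`. -/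
def rankOneC (γ : G → ℝ) (z : G) : Fin 2 → ℝ := ![γ z, γ z]

variable (α β γ : G → ℝ) (s : G)

/-- The class point of the cell `(x, y)` (third letter `z = s - x - y`). -/
def rkPt (p : G × G) : Fin 2 → ℝ := rankOneA α p.1 + rankOneB β p.2 + rankOneC γ (s - p.1 - p.2)

omit [Fintype G] in
/-- Coordinates of a rank-one class point: `(α x + γ z, β y + γ z)`. [folklore] -/
theorem rkPt_apply_zero (p : G × G) : rkPt α β γ s p 0 = α p.1 + γ (s - p.1 - p.2) := by
  simp [rkPt, rankOneA, rankOneB, rankOneC]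

omit [Fintype G] in
/-- Coordinates of a rank-one class point: `(α x + γ z, β y + γ z)`. [folklore] -/
theorem rkPt_apply_one (p : G × G) : rkPt α β γ s p 1 = β p.2 + γ (s - p.1 - p.2) := by
  simp [rkPt, rankOneA, rankOneB, rankOneC]

/-- The class of a rank-one configuration as a `Finset` (image of `G × G`). -/
noncomputable def rkFin : Finset (Fin 2 → ℝ) := by classical exact Finset.univ.image (rkPt α β γ s)

omit [Fintype G] in
/-- The class point set of the rank-one configuration is the range of `rkPt`. [folklore] -/
theorem classPts_rankOne_eq : classPts (rankOneA α) (rankOneB β) (rankOneC γ) s = Set.range (rkPt α β γ s) := rfl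

/-- The `Finset` form of the class. [folklore] -/
theorem coe_rkFin : (rkFin α β γ s : Set (Fin 2 → ℝ)) = classPts (rankOneA α) (rankOneB β) (rankOneC γ) s := by
  classical
  unfold rkFin
  rw [Finset.coe_image, Finset.coe_univ, Set.image_univ, classPts_rankOne_eq]

end RankOne

/-- **Pointwise rank-one law with constant `C`** (conjecture-grade, OPEN; memo NOTES-t1g19 §2): for every finite abelian `G`,
all labellings `α β γ : G → ℝ` and EVERY class `s`, `V_s ≤ C·|G|` for the rank-one alphabets `(α x, 0)`, `(0, β y)`, `(γ z, γ z)`.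
(For planar alphabets this is false: one class can hold `|G|²/4` vertices.)  Follows from `EnvelopeBound` with `6C`
(`envelopeBound_imp_rankOnePointwise`).  Not asserted anywhere. -/
@[conjecture] def RankOnePointwise (C : ℕ) : Prop :=
  ∀ (G : Type) [AddCommGroup G] [Fintype G] (α β γ : G → ℝ) (s : G),
    classVert (rankOneA α) (rankOneB β) (rankOneC γ) s ≤ C * Fintype.card G

/-! ### Affine transport of strict tops -/

/-- The pairing with a weight `(u, v)`. [folklore] -/
theorem vec2_dot (u v : ℝ) (p : Fin 2 → ℝ) : ![u, v] ⬝ᵥ p = u * p 0 + v * p 1 := by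
  simp [dotProduct, Fin.sum_univ_two]

/-- **Transport.**  If `p` is the strict top of `F` for `w` and `w' ⬝ L q = m⁻¹ (w ⬝ q)` for all `q` with `m > 0`, then `L p` is
the strict top of `L(F)` for `w'` (no injectivity needed). [folklore] -/
theorem isStrictTop_image_of_compat {F : Finset (Fin 2 → ℝ)} {p w w' : Fin 2 → ℝ} (h : IsStrictTop w F p)
    (L : (Fin 2 → ℝ) → (Fin 2 → ℝ)) {m : ℝ} (hm : 0 < m)
    (hc : ∀ q, w' ⬝ᵥ L q = m⁻¹ * (w ⬝ᵥ q)) [DecidableEq (Fin 2 → ℝ)] :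
    IsStrictTop w' (F.image L) (L p) := by
  refine ⟨Finset.mem_image.2 ⟨p, h.1, rfl⟩, fun y hy hne => ?_⟩
  obtain ⟨q, hq, rfl⟩ := Finset.mem_image.1 hy
  have hqp : q ≠ p := fun e => hne (by rw [e])
  rw [hc, hc]
  exact mul_lt_mul_of_pos_left (h.2 q hq hqp) (inv_pos.2 hm)

/-! ### The six sectors and their (ENV) instances -/

section Sectors

variable {G : Type*} [AddCommGroup G] [Fintype G]
variable (α β γ : G → ℝ) (s : G)

/-- Sector maps `L₁ … L₆ : ℝ² → ℝ²`. -/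
def L₁ (p : Fin 2 → ℝ) : Fin 2 → ℝ := ![-p 1, -p 0]
/-- Sector map 2. -/
def L₂ (p : Fin 2 → ℝ) : Fin 2 → ℝ := ![p 1, p 0]
/-- Sector map 3. -/
def L₃ (p : Fin 2 → ℝ) : Fin 2 → ℝ := ![-p 0, p 1 - p 0]
/-- Sector map 4. -/
def L₄ (p : Fin 2 → ℝ) : Fin 2 → ℝ := ![p 0, p 0 - p 1]
/-- Sector map 5. -/
def L₅ (p : Fin 2 → ℝ) : Fin 2 → ℝ := ![-p 1, p 0 - p 1]
/-- Sector map 6. -/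
def L₆ (p : Fin 2 → ℝ) : Fin 2 → ℝ := ![p 1, p 1 - p 0]

/-- `L₁` is injective. [folklore] -/
theorem L₁_injective : Function.Injective L₁ := by
  intro p q h
  have h0 := congrFun h 0; have h1 := congrFun h 1
  simp only [L₁, cons_val_zero, cons_val_one] at h0 h1
  ext i; fin_cases i <;> simp <;> linarith

/-- `L₂` is injective. [folklore] -/
theorem L₂_injective : Function.Injective L₂ := by
  intro p q h
  have h0 := congrFun h 0; have h1 := congrFun h 1
  simp only [L₂, cons_val_zero, cons_val_one] at h0 h1
  ext i; fin_cases i <;> simp <;> linarith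

/-- `L₃` is injective. [folklore] -/
theorem L₃_injective : Function.Injective L₃ := by
  intro p q h
  have h0 := congrFun h 0; have h1 := congrFun h 1
  simp only [L₃, cons_val_zero, cons_val_one] at h0 h1
  ext i; fin_cases i <;> simp <;> linarith

/-- `L₄` is injective. [folklore] -/
theorem L₄_injective : Function.Injective L₄ := by
  intro p q h
  have h0 := congrFun h 0; have h1 := congrFun h 1
  simp only [L₄, cons_val_zero, cons_val_one] at h0 h1
  ext i; fin_cases i <;> simp <;> linarith

/-- `L₅` is injective. [folklore] -/
theorem L₅_injective : Function.Injective L₅ := by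
  intro p q h
  have h0 := congrFun h 0; have h1 := congrFun h 1
  simp only [L₅, cons_val_zero, cons_val_one] at h0 h1
  ext i; fin_cases i <;> simp <;> linarith

/-- `L₆` is injective. [folklore] -/
theorem L₆_injective : Function.Injective L₆ := by
  intro p q h
  have h0 := congrFun h 0; have h1 := congrFun h 1
  simp only [L₆, cons_val_zero, cons_val_one] at h0 h1
  ext i; fin_cases i <;> simp <;> linarith

/-- The six (ENV) instances of class `s`: `(φ, ψ, c)` triples. -/
def inst₁ : (G → ℝ) × (G → ℝ) × (G → ℝ) := (fun x => -α x, fun y => -β y, fun r => -γ (s - r))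
/-- Instance 2. -/
def inst₂ : (G → ℝ) × (G → ℝ) × (G → ℝ) := (α, β, fun r => γ (s - r))
/-- Instance 3 (cells `(y, z)`, static letter `x`). -/
def inst₃ : (G → ℝ) × (G → ℝ) × (G → ℝ) := (β, fun z => -γ z, fun r => -α (s - r))
/-- Instance 4. -/
def inst₄ : (G → ℝ) × (G → ℝ) × (G → ℝ) := (fun y => -β y, γ, fun r => α (s - r))
/-- Instance 5 (cells `(x, z)`, static letter `y`). -/
def inst₅ : (G → ℝ) × (G → ℝ) × (G → ℝ) := (α, fun z => -γ z, fun r => -β (s - r))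
/-- Instance 6. -/
def inst₆ : (G → ℝ) × (G → ℝ) × (G → ℝ) := (fun x => -α x, γ, fun r => β (s - r))

/-- `envPieces` of a packed instance. -/
noncomputable def envPieces₃ (I : (G → ℝ) × (G → ℝ) × (G → ℝ)) : ℕ := envPieces I.1 I.2.1 I.2.2

/-- Reindexing `(x, y) ↦ (y, s - x - y)` (second and third letters). -/
def eYZ : G × G ≃ G × G where
  toFun p := (p.2, s - p.1 - p.2)
  invFun p := (s - p.1 - p.2, p.1)
  left_inv p := by
    obtain ⟨x, y⟩ := p
    refine Prod.ext ?_ rfl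
    change s - y - (s - x - y) = x
    abel
  right_inv p := by
    obtain ⟨y, z⟩ := p
    refine Prod.ext rfl ?_
    change s - (s - y - z) - y = z
    abel

/-- Reindexing `(x, y) ↦ (x, s - x - y)` (first and third letters). -/
def eXZ : G × G ≃ G × G where
  toFun p := (p.1, s - p.1 - p.2)
  invFun p := (p.1, s - p.1 - p.2)
  left_inv p := by
    obtain ⟨x, y⟩ := p
    refine Prod.ext rfl ?_
    change s - x - (s - x - y) = y
    abel
  right_inv p := by
    obtain ⟨x, z⟩ := p
    refine Prod.ext rfl ?_
    change s - x - (s - x - z) = z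
    abel

/-- Image of `univ` under `f ∘ e` for an equivalence `e`. [folklore] -/
theorem image_univ_comp_equiv {ι δ : Type*} [Fintype ι] [DecidableEq δ] (f : ι → δ) (e : ι ≃ ι) :
    Finset.univ.image (fun p => f (e p)) = Finset.univ.image f := by
  ext v
  simp only [Finset.mem_image, Finset.mem_univ, true_and]
  constructor
  · rintro ⟨p, rfl⟩; exact ⟨e p, rfl⟩
  · rintro ⟨p, rfl⟩; exact ⟨e.symm p, by simp⟩

/-- Instance 1 is the image of the class under `L₁`. -/
theorem envPts_inst₁ : envPts (inst₁ α β γ s).1 (inst₁ α β γ s).2.1 (inst₁ α β γ s).2.2 = (rkFin α β γ s).image L₁ := by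
  classical
  unfold envPts rkFin
  rw [Finset.image_image]
  refine Finset.image_congr fun p _ => ?_
  ext i; fin_cases i
  · simp only [envPt, inst₁, L₁, Function.comp_apply, rkPt_apply_zero, rkPt_apply_one, sub_sub, cons_val_zero, 
      Fin.zero_eta, Fin.isValue]
    first | rfl | ring
  · simp only [envPt, inst₁, L₁, Function.comp_apply, rkPt_apply_zero, rkPt_apply_one, sub_sub, cons_val_zero, cons_val_one,
      Fin.mk_one, Fin.isValue]
    first | rfl | ring

/-- Instance 2 is the image of the class under `L₂`. -/
theorem envPts_inst₂ : envPts (inst₂ α β γ s).1 (inst₂ α β γ s).2.1 (inst₂ α β γ s).2.2 = (rkFin α β γ s).image L₂ := by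
  classical
  unfold envPts rkFin
  rw [Finset.image_image]
  refine Finset.image_congr fun p _ => ?_
  ext i; fin_cases i
  · simp only [envPt, inst₂, L₂, Function.comp_apply, rkPt_apply_zero, rkPt_apply_one, sub_sub, cons_val_zero, 
      Fin.zero_eta, Fin.isValue]
  · simp only [envPt, inst₂, L₂, Function.comp_apply, rkPt_apply_zero, rkPt_apply_one, sub_sub, cons_val_zero, cons_val_one,
      Fin.mk_one, Fin.isValue]

/-- Instance 3 is the image of the class under `L₃` (after reindexing by `eYZ`). -/
theorem envPts_inst₃ : envPts (inst₃ α β γ s).1 (inst₃ α β γ s).2.1 (inst₃ α β γ s).2.2 = (rkFin α β γ s).image L₃ := by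
  classical
  unfold envPts rkFin
  rw [Finset.image_image, ← image_univ_comp_equiv (envPt (inst₃ α β γ s).1 (inst₃ α β γ s).2.1 (inst₃ α β γ s).2.2) (eYZ s)]
  refine Finset.image_congr fun p _ => ?_
  have h2 : p.2 + (s - p.1 - p.2) = s - p.1 := by abel
  ext i; fin_cases i
  · simp only [envPt, inst₃, L₃, eYZ, Equiv.coe_fn_mk, Function.comp_apply, rkPt_apply_zero, rkPt_apply_one, h2,
      sub_sub_cancel, cons_val_zero, Fin.zero_eta, Fin.isValue]
    first | rfl | ring
  · simp only [envPt, inst₃, L₃, eYZ, Equiv.coe_fn_mk, Function.comp_apply, rkPt_apply_zero, rkPt_apply_one, h2,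
      sub_sub_cancel, cons_val_zero, cons_val_one, Fin.mk_one, Fin.isValue]
    first | rfl | ring

/-- Instance 4 is the image of the class under `L₄` (after reindexing by `eYZ`). -/
theorem envPts_inst₄ : envPts (inst₄ α β γ s).1 (inst₄ α β γ s).2.1 (inst₄ α β γ s).2.2 = (rkFin α β γ s).image L₄ := by
  classical
  unfold envPts rkFin
  rw [Finset.image_image, ← image_univ_comp_equiv (envPt (inst₄ α β γ s).1 (inst₄ α β γ s).2.1 (inst₄ α β γ s).2.2) (eYZ s)]
  refine Finset.image_congr fun p _ => ?_
  have h2 : p.2 + (s - p.1 - p.2) = s - p.1 := by abel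
  ext i; fin_cases i
  · simp only [envPt, inst₄, L₄, eYZ, Equiv.coe_fn_mk, Function.comp_apply, rkPt_apply_zero, rkPt_apply_one, h2,
      sub_sub_cancel, cons_val_zero, Fin.zero_eta, Fin.isValue]
    first | rfl | ring
  · simp only [envPt, inst₄, L₄, eYZ, Equiv.coe_fn_mk, Function.comp_apply, rkPt_apply_zero, rkPt_apply_one, h2,
      sub_sub_cancel, cons_val_zero, cons_val_one, Fin.mk_one, Fin.isValue]
    first | rfl | ring

/-- Instance 5 is the image of the class under `L₅` (after reindexing by `eXZ`). -/
theorem envPts_inst₅ : envPts (inst₅ α β γ s).1 (inst₅ α β γ s).2.1 (inst₅ α β γ s).2.2 = (rkFin α β γ s).image L₅ := by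
  classical
  unfold envPts rkFin
  rw [Finset.image_image, ← image_univ_comp_equiv (envPt (inst₅ α β γ s).1 (inst₅ α β γ s).2.1 (inst₅ α β γ s).2.2) (eXZ s)]
  refine Finset.image_congr fun p _ => ?_
  have h2 : p.1 + (s - p.1 - p.2) = s - p.2 := by abel
  ext i; fin_cases i
  · simp only [envPt, inst₅, L₅, eXZ, Equiv.coe_fn_mk, Function.comp_apply, rkPt_apply_zero, rkPt_apply_one, h2,
      sub_sub_cancel, cons_val_zero, Fin.zero_eta, Fin.isValue]
    first | rfl | ring
  · simp only [envPt, inst₅, L₅, eXZ, Equiv.coe_fn_mk, Function.comp_apply, rkPt_apply_zero, rkPt_apply_one, h2,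
      sub_sub_cancel, cons_val_zero, cons_val_one, Fin.mk_one, Fin.isValue]
    first | rfl | ring

/-- Instance 6 is the image of the class under `L₆` (after reindexing by `eXZ`). -/
theorem envPts_inst₆ : envPts (inst₆ α β γ s).1 (inst₆ α β γ s).2.1 (inst₆ α β γ s).2.2 = (rkFin α β γ s).image L₆ := by
  classical
  unfold envPts rkFin
  rw [Finset.image_image, ← image_univ_comp_equiv (envPt (inst₆ α β γ s).1 (inst₆ α β γ s).2.1 (inst₆ α β γ s).2.2) (eXZ s)]
  refine Finset.image_congr fun p _ => ?_
  have h2 : p.1 + (s - p.1 - p.2) = s - p.2 := by abel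
  ext i; fin_cases i
  · simp only [envPt, inst₆, L₆, eXZ, Equiv.coe_fn_mk, Function.comp_apply, rkPt_apply_zero, rkPt_apply_one, h2,
      sub_sub_cancel, cons_val_zero, Fin.zero_eta, Fin.isValue]
    first | rfl | ring
  · simp only [envPt, inst₆, L₆, eXZ, Equiv.coe_fn_mk, Function.comp_apply, rkPt_apply_zero, rkPt_apply_one, h2,
      sub_sub_cancel, cons_val_zero, cons_val_one, Fin.mk_one, Fin.isValue]
    first | rfl | ring

end Sectors

end TotalsLaw

end Summit.ValiantsHypothesis.ValiantsHypothesis.Theorems.NewtonUnitEquationsDissociatedUniform
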